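import Literature.NumberTheory.EllipticCurves.ZpExtensionEisensteinDVRSettingDualityDataProofs
import Literature.NumberTheory.EllipticCurves.IwasawaAlgebraEisensteinTwistedInvariantsReadout
import HarnessLib

/-!
# Non-degeneracy of the `E`-level form RECOVERED from the perfect duality form of the Eisenstein levels (theorems
# only; no definition, no named fact, no instance, no `sorry`)

Topic `NumberTheory/EllipticCurves` (sequel to `ZpExtensionEisensteinTwistDualityForm` — the `A_{m,k}`-bilinear form
`E = eisensteinDualityForm hm k eb`, `E(c₁ ⊗ a₁, c₂ ⊗ a₂) = c₁ c₂ ι(eb(a₁, a₂))`, and its perfectness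
`eisensteinDualityForm_bijective` FROM the non-degeneracy of `eb` — and to `ZpExtensionEisensteinDVRSettingDualityDataProofs`
(the instantiated H.4 data `D k` of the curve's Eisenstein setting, exported with `(D k).e = eisensteinDualityForm hm (k+1)
(conjPairing (e (k+1)) τ_* (log (k+1)))` but WITHOUT the non-degeneracy of the Weil–`τ` form); cell `pub/bsd-print-x9`,
brick (B3)-support of `HOME/p1/H4-EXACT-AT-P-PLAN`: the `E`-level right-non-degeneracy input `hnd` of
`conjPairing_restricted_right_exact` / `_exhausting` (Howard's H.4 at `v ∣ p`, Lemma 3.1.1)).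

Howard [Compositio Math. 140 (2004), §1.3 H.4 («a perfect, symmetric pairing») and Lemma 2.1.1 (`e_𝔮(t₁ ⊗ α₁, t₂ ⊗ α₂) =
e(t₁, t₂^τ) α₁ α₂`), arXiv:1202.6340 p. 7 L69–88]: the finite-level datum is perfect BECAUSE the Weil pairing is; this file
proves the CONVERSE direction, so that a consumer holding only the packaged datum `D` (a `Howard2004.DualityDatum`, fields
`perfect`, `symm`) and the identification `hDe : D.e = eisensteinDualityForm hm k eb` recovers the `E`-level facts:

* §1 (pure `A_{m,k}`-algebra, `M` killed by `p^k`): `Twisted.eq_zero_of_tmul_one_eq_zero` (`1 ⊗ a = 0 ⇒ a = 0`, tail-form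
  coordinates), **`nondegenerate_left_of_injective_eisensteinDualityForm`** (`E` injective ⇒ `eb` left-non-degenerate),
  `symm_of_eisensteinDualityForm_symm` (`E` symmetric ⇒ `eb` symmetric; `ι = ofZMod` injective),
  `nondegenerate_right_of_injective_eisensteinDualityForm`;
* §2 `nondegenerate_of_dualityDatum_e_eq` — the same packaged on a `DualityDatum` with `hDe`;
* §3 `conjPairing` unpacked: for `θ` involutive, non-degeneracy of `ẽ = conjPairing e θ log` on either side gives
  **`∀ b, (∀ a, log (e a b) = 0) → b = 0`** and the left twin (`log_conjPairing_nondegenerate_right/left`), and the same for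
  the `μ`-valued `e` itself (`base_conjPairing_nondegenerate_right/left`);
* §4 the curve: **`WeierstrassCurve.weilLog_nondegenerate_of_dualityDatum_e_eq`** — in the literal types of the exports
  `exists_eisensteinDualityData[_unitTwist]` / the frames' setting-data theorem (inputs `D k`, `e (k+1)`, `log (k+1)`, `hDe k`
  and `τ_* τ_* = id`): `ẽ_{k+1}` is symmetric and non-degenerate on both sides, and `log ∘ e_{k+1}` and `e_{k+1}` are
  non-degenerate on both sides of `E_K[p^{k+1}]`.

No summit statement is proved; BSD is not proved by any of this.  Seat `bsd-line-x9-p1-w4` g7.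

References: [Howard2004HeegnerKolyvagin] §1.3 H.4, Rem. 1.3.2, Lemma 2.1.1, Lemma 3.1.1 (arXiv:1202.6340 p. 7 L69–88, p. 15 L60–62);
[DeSmitRubinSchoof1997] Cor. 2.2 (dual basis of a monogenic algebra); [SilvermanAEC2009] III.8.1 (the Weil pairing is perfect).
-/

noncomputable section

open scoped TensorProduct
open Function

namespace Literature.NumberTheory.EllipticCurves

namespace ZpExtension

open IwasawaAlgebra Literature.NumberTheory.GaloisRepresentations Literature.NumberTheory.GaloisCohomology.Howard2004

variable {p : ℕ} [hp : Fact p.Prime] {m : ℕ} (hm : 1 ≤ m) (k : ℕ)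
  {M₁ : Type} {M₂ : Type} [AddCommGroup M₁] [AddCommGroup M₂] (eb : M₁ →+ M₂ →+ ZMod (p ^ k))

/-! ## §1 From the perfect `A_{m,k}`-form back to the `E`-level form -/

include hm in
/-- **`1 ⊗ a = 0` in `M ⊗ A_{m,k}` forces `a = 0`** when `M` is killed by `p^k` (`m ≥ 1`): the `[π₀^*]`-translate of
`1 ⊗ a = [T^0] ⊗ a` reads `a` under the tail readout (`Twisted.tailReadout_dualFamily_smul_sum`).
[cite: DeSmitRubinSchoof1997, Cor. 2.2 (case n = 1)] [cite: Howard2004HeegnerKolyvagin, §2.2 (T_𝔮/p^k = T_pE/p^k ⊗ S_𝔮/p^k)] -/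
theorem _root_.Literature.NumberTheory.EllipticCurves.IwasawaAlgebra.EisensteinCoeff.Twisted.eq_zero_of_tmul_one_eq_zero
    {M : Type} [AddCommGroup M] (hM : ∀ a : M, (p ^ k) • a = 0) {a : M}
    (ha : EisensteinCoeff.Twisted.tmul (1 : EisensteinCoeff p m k) a = 0) : a = 0 := by
  classical
  -- the coordinate vector `w = (a, 0, …, 0)` in the power basis `[T^i]`
  let w : Fin m → M := fun i ↦ if i = (⟨0, hm⟩ : Fin m) then a else 0
  have hsum : (∑ i : Fin m, EisensteinCoeff.Twisted.tmul
      (Ideal.Quotient.mk _ ((PowerSeries.X : IwasawaAlgebra p) ^ (i : ℕ)) : EisensteinCoeff p m k) (w i)) =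
      EisensteinCoeff.Twisted.tmul (1 : EisensteinCoeff p m k) a := by
    rw [Finset.sum_eq_single (⟨0, hm⟩ : Fin m)]
    · simp only [w, if_pos rfl, pow_zero, map_one]
    · intro i _ hi
      simp only [w, if_neg hi, EisensteinCoeff.Twisted.tmul_zero]
    · intro h0; exact absurd (Finset.mem_univ _) h0
  have h := EisensteinCoeff.Twisted.tailReadout_dualFamily_smul_sum p hm k hM w ⟨0, hm⟩
  rw [hsum, ha, smul_zero, map_zero] at h
  have hw : w ⟨0, hm⟩ = a := if_pos rfl
  rw [← hw, ← h]

/-- `E(1 ⊗ a, y) = 0` for every `y` when `eb(a, ·) = 0` (pure tensors: `E(1 ⊗ a, c ⊗ b) = c ι(eb(a, b))`).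
[cite: Howard2004HeegnerKolyvagin, Lemma 2.1.1] -/
theorem eisensteinDualityForm_tmul_one_apply_eq_zero {a : M₁} (ha : ∀ b : M₂, eb a b = 0)
    (y : EisensteinCoeff.Twisted p m k M₂) :
    eisensteinDualityForm hm k eb (EisensteinCoeff.Twisted.tmul (1 : EisensteinCoeff p m k) a) y = 0 := by
  induction y using EisensteinCoeff.Twisted.induction_on with
  | zero => rw [map_zero]
  | tmul c b =>
    rw [show eisensteinDualityForm hm k eb (EisensteinCoeff.Twisted.tmul (1 : EisensteinCoeff p m k) a)
        (EisensteinCoeff.Twisted.tmul c b) = 1 * c * EisensteinCoeff.ofZMod p hm k (eb a b) from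
      scalarForm_tmul_tmul (EisensteinCoeff.ofZMod p hm k) eb 1 c a b, ha, map_zero, mul_zero]
  | add y y' hy hy' => rw [map_add, hy, hy', add_zero]

/-- **Injectivity of the `A_{m,k}`-form gives LEFT non-degeneracy of `eb`** (`M₁` killed by `p^k`): if `eb(a, ·) = 0`
then `E(1 ⊗ a, ·) = 0 = E(0, ·)`, so `1 ⊗ a = 0`, so `a = 0`.  Converse of (half of) `eisensteinDualityForm_bijective`.
[cite: Howard2004HeegnerKolyvagin, §1.3 H.4 («perfect») and Lemma 2.1.1] -/
theorem nondegenerate_left_of_injective_eisensteinDualityForm (hM₁ : ∀ a : M₁, (p ^ k) • a = 0)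
    (hinj : Function.Injective (eisensteinDualityForm hm k eb)) (a : M₁) (ha : ∀ b : M₂, eb a b = 0) : a = 0 := by
  refine EisensteinCoeff.Twisted.eq_zero_of_tmul_one_eq_zero hm k hM₁ (hinj ?_)
  rw [map_zero]
  exact LinearMap.ext fun y ↦ by
    rw [LinearMap.zero_apply]; exact eisensteinDualityForm_tmul_one_apply_eq_zero hm k eb ha y

/-- `ι = ofZMod : ℤ/p^k → A_{m,k}` is injective (`char A_{m,k} = p^k`, `m ≥ 1`). [cite: Washington1997, §13.2] -/
theorem _root_.Literature.NumberTheory.EllipticCurves.IwasawaAlgebra.EisensteinCoeff.ofZMod_injective :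
    Function.Injective (EisensteinCoeff.ofZMod p hm k) := by
  haveI := EisensteinCoeff.charP p hm k
  intro x y hxy
  rw [EisensteinCoeff.ofZMod_apply, EisensteinCoeff.ofZMod_apply] at hxy
  have h := (CharP.natCast_eq_natCast (EisensteinCoeff p m k) (p ^ k)).mp hxy
  rw [← ZMod.natCast_zmod_val x, ← ZMod.natCast_zmod_val y]
  exact (ZMod.natCast_eq_natCast_iff' _ _ _).mpr h

/-- **Symmetry of the `A_{m,k}`-form gives symmetry of `eb`**: `E(1 ⊗ a, 1 ⊗ b) = ι(eb(a, b))` and `ι` is injective.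
[cite: Howard2004HeegnerKolyvagin, §1.3 H.4 («symmetric») and Lemma 2.1.1] -/
theorem symm_of_eisensteinDualityForm_symm {M : Type} [AddCommGroup M] (eb : M →+ M →+ ZMod (p ^ k))
    (hsymm : ∀ s t : EisensteinCoeff.Twisted p m k M, eisensteinDualityForm hm k eb s t = eisensteinDualityForm hm k eb t s)
    (a b : M) : eb a b = eb b a := by
  have h := hsymm (EisensteinCoeff.Twisted.tmul 1 a) (EisensteinCoeff.Twisted.tmul 1 b)
  rw [show eisensteinDualityForm hm k eb (EisensteinCoeff.Twisted.tmul (1 : EisensteinCoeff p m k) a)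
        (EisensteinCoeff.Twisted.tmul 1 b) = 1 * 1 * EisensteinCoeff.ofZMod p hm k (eb a b) from
      scalarForm_tmul_tmul (EisensteinCoeff.ofZMod p hm k) eb 1 1 a b,
    show eisensteinDualityForm hm k eb (EisensteinCoeff.Twisted.tmul (1 : EisensteinCoeff p m k) b)
        (EisensteinCoeff.Twisted.tmul 1 a) = 1 * 1 * EisensteinCoeff.ofZMod p hm k (eb b a) from
      scalarForm_tmul_tmul (EisensteinCoeff.ofZMod p hm k) eb 1 1 b a] at h
  simp only [one_mul] at h
  exact EisensteinCoeff.ofZMod_injective hm k h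

/-- **RIGHT non-degeneracy of `eb`** from an injective and symmetric `A_{m,k}`-form (`M` killed by `p^k`).
[cite: Howard2004HeegnerKolyvagin, §1.3 H.4 («perfect, symmetric»)] -/
theorem nondegenerate_right_of_injective_eisensteinDualityForm {M : Type} [AddCommGroup M]
    (eb : M →+ M →+ ZMod (p ^ k)) (hM : ∀ a : M, (p ^ k) • a = 0)
    (hinj : Function.Injective (eisensteinDualityForm hm k eb))
    (hsymm : ∀ s t : EisensteinCoeff.Twisted p m k M, eisensteinDualityForm hm k eb s t = eisensteinDualityForm hm k eb t s)
    (b : M) (hb : ∀ a : M, eb a b = 0) : b = 0 :=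
  nondegenerate_left_of_injective_eisensteinDualityForm hm k eb hM hinj b fun a ↦ by
    rw [symm_of_eisensteinDualityForm_symm hm k eb hsymm b a]; exact hb a

/-! ## §2 Packaged on a `DualityDatum` -/

/-- **The `E`-level form of a perfect symmetric Eisenstein datum is symmetric and non-degenerate on both sides.**  For a
`DualityDatum` `D` on `M ⊗ A_{m,k}` (any Galois structure `ρ`, any conjugation datum) whose pairing IS
`eisensteinDualityForm hm k eb` (`hDe`, e.g. `eisensteinDualityDatum_e` or the exported identification of
`WeierstrassCurve.exists_eisensteinDualityData`), with `M` killed by `p^k`: `eb` is symmetric, left- and right-non-degenerate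
(fields `perfect`, `symm` of `D` + §1). [cite: Howard2004HeegnerKolyvagin, §1.3 H.4 and Lemma 2.1.1 (arXiv p. 7, L69–80)] -/
theorem nondegenerate_of_dualityDatum_e_eq {K : Type} [Field K] [NumberField K] {cd : ConjugationDatum K}
    {M : Type} [AddCommGroup M] {ρ : DiscreteGaloisModule K (EisensteinCoeff.Twisted p m k M)}
    (D : DualityDatum p cd ρ (EisensteinCoeff p m k)) (eb : M →+ M →+ ZMod (p ^ k))
    (hDe : D.e = eisensteinDualityForm hm k eb) (hM : ∀ a : M, (p ^ k) • a = 0) :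
    (∀ a b : M, eb a b = eb b a) ∧ (∀ a : M, (∀ b : M, eb a b = 0) → a = 0) ∧
      (∀ b : M, (∀ a : M, eb a b = 0) → b = 0) := by
  have hinj : Function.Injective (eisensteinDualityForm hm k eb) := by rw [← hDe]; exact D.perfect.1
  have hsymm : ∀ s t : EisensteinCoeff.Twisted p m k M,
      eisensteinDualityForm hm k eb s t = eisensteinDualityForm hm k eb t s := fun s t ↦ by rw [← hDe]; exact D.symm s t
  exact ⟨symm_of_eisensteinDualityForm_symm hm k eb hsymm,
    nondegenerate_left_of_injective_eisensteinDualityForm hm k eb hM hinj,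
    nondegenerate_right_of_injective_eisensteinDualityForm hm k eb hM hinj hsymm⟩

end ZpExtension

/-! ## §3 Unpacking `ẽ = conjPairing e θ log` for an involution `θ` -/

section ConjPairing

open Literature.NumberTheory.GaloisRepresentations

variable {K : Type} [Field K] {M : Type} [AddCommGroup M] {n : ℕ}
  (e : M →+ M →+ DiscreteGaloisModule.MuCarrier K n) (θ : M →+ M) (log : DiscreteGaloisModule.MuCarrier K n →+ ZMod n)

/-- **Right non-degeneracy of `log ∘ e` from right non-degeneracy of `ẽ(a, b) = log e(a, θ b)`** (`θ` involutive):
if `log e(a, b) = 0` for all `a` then `ẽ(a, θ b) = log e(a, θθ b) = 0` for all `a`, so `θ b = 0`, so `b = θ θ b = 0`.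
[cite: Howard2004HeegnerKolyvagin, Rem. 1.3.2 and H.4 («perfect»)] -/
theorem log_conjPairing_nondegenerate_right (hθθ : ∀ a : M, θ (θ a) = a)
    (hnd : ∀ b : M, (∀ a : M, conjPairing e θ log a b = 0) → b = 0) (b : M) (hb : ∀ a : M, log (e a b) = 0) :
    b = 0 := by
  have h : θ b = 0 := hnd (θ b) fun a ↦ by rw [conjPairing_apply, hθθ]; exact hb a
  rw [← hθθ b, h, map_zero]

/-- **Left non-degeneracy of `log ∘ e` from left non-degeneracy of `ẽ`**: if `log e(a, b) = 0` for all `b` then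
`ẽ(a, b) = log e(a, θ b) = 0` for all `b`, so `a = 0`. [cite: Howard2004HeegnerKolyvagin, Rem. 1.3.2 and H.4 («perfect»)] -/
theorem log_conjPairing_nondegenerate_left (hnd : ∀ a : M, (∀ b : M, conjPairing e θ log a b = 0) → a = 0) (a : M)
    (ha : ∀ b : M, log (e a b) = 0) : a = 0 :=
  hnd a fun b ↦ by rw [conjPairing_apply]; exact ha (θ b)

/-- **Right non-degeneracy of the `μ`-valued `e` itself** from right non-degeneracy of `ẽ` (`θ` involutive; no hypothesis
on `log`: `log 0 = 0`). [cite: Howard2004HeegnerKolyvagin, Rem. 1.3.2 and H.4 («perfect»)] [cite: SilvermanAEC2009, Prop. III.8.1] -/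
theorem base_conjPairing_nondegenerate_right (hθθ : ∀ a : M, θ (θ a) = a)
    (hnd : ∀ b : M, (∀ a : M, conjPairing e θ log a b = 0) → b = 0) (b : M) (hb : ∀ a : M, e a b = 0) : b = 0 :=
  log_conjPairing_nondegenerate_right e θ log hθθ hnd b fun a ↦ by rw [hb a, map_zero]

/-- **Left non-degeneracy of the `μ`-valued `e` itself** from left non-degeneracy of `ẽ`.
[cite: Howard2004HeegnerKolyvagin, Rem. 1.3.2 and H.4 («perfect»)] [cite: SilvermanAEC2009, Prop. III.8.1] -/
theorem base_conjPairing_nondegenerate_left (hnd : ∀ a : M, (∀ b : M, conjPairing e θ log a b = 0) → a = 0) (a : M)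
    (ha : ∀ b : M, e a b = 0) : a = 0 :=
  log_conjPairing_nondegenerate_left e θ log hnd a fun b ↦ by rw [ha b, map_zero]

end ConjPairing

end Literature.NumberTheory.EllipticCurves

/-! ## §4 The curve: non-degeneracy of the Weil–`τ` form and of `log ∘ e` from the exported H.4 datum -/

namespace WeierstrassCurve

open Literature.NumberTheory.EllipticCurves Literature.NumberTheory.GaloisRepresentations
open Literature.NumberTheory.GaloisRepresentations.DiscreteGaloisModule
open Literature.NumberTheory.GaloisCohomology.Howard2004
open Literature.NumberTheory.EllipticCurves.IwasawaAlgebra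

variable {K : Type} [Field K] [NumberField K] (W : WeierstrassCurve ℚ) [W.IsElliptic] {p : ℕ} [hp : Fact p.Prime]
  (κ : ZpExtension K p) {m : ℕ} (hm : 1 ≤ m) (cd : ConjugationDatum K)

omit hp [W.IsElliptic] in
/-- `p^j · E_K[p^j] = 0` (as a natural-number multiple). [cite: SilvermanAEC2009, Cor. III.6.4] -/
theorem geomTorsion_baseChange_pow_nsmul_eq_zero (j : ℕ) (a : geomTorsion (W.baseChange K) ((p : ℤ) ^ j)) :
    (p ^ j) • a = 0 := by
  apply Subtype.ext
  have h := (mem_geomTorsion_iff (W.baseChange K) _ (a : geomPoints (W.baseChange K))).1 a.2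
  rw [AddSubgroupClass.coe_nsmul, ZeroMemClass.coe_zero, ← natCast_zsmul, Nat.cast_pow]
  exact h

/-- **Non-degeneracy of the Weil–`τ` form and of `log ∘ e` at level `k+1`, from the exported H.4 datum.**  In the literal
types of `exists_eisensteinDualityData` / `exists_eisensteinDualityData_unitTwist` / the frames' setting-data theorem: given
the datum `D` on `T^{(k)} = E_K[p^{k+1}] ⊗ A_{m,k+1}(ψ)` (their `D k`), the Weil family member `e` (their `e (k+1)`), the
logarithm `log` (their `log (k+1)`), the identification `hDe` (their first exported conjunct at `k`) and `τ_* τ_* = id`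
(their seventh), with `ẽ = conjPairing e τ_* log`: (1) `ẽ` is symmetric; (2) `ẽ(w, ·) = 0 ⇒ w = 0`; (3) `ẽ(·, b) = 0 ⇒ b = 0`;
(4) `(∀ b, log e(a, b) = 0) ⇒ a = 0`; (5) `(∀ a, log e(a, b) = 0) ⇒ b = 0`; (6) `(∀ b, e(a, b) = 0) ⇒ a = 0`;
(7) `(∀ a, e(a, b) = 0) ⇒ b = 0` (the `μ`-valued Weil form itself) — the `E`-level inputs `hnd` of the restricted perfectness
lemmas `conjPairing_restricted_right_exact` / `_exhausting` / `conjPairing_torsionFilAt_clauses` (Howard's H.4 at `v ∣ p`).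
[cite: Howard2004HeegnerKolyvagin, §1.3 H.4, Rem. 1.3.2, Lemma 2.1.1, Lemma 3.1.1 (arXiv p. 7 L69–88, p. 15 L60–62)]
[cite: SilvermanAEC2009, Prop. III.8.1] -/
theorem weilLog_nondegenerate_of_dualityDatum_e_eq (k : ℕ) :
    letI := IwasawaAlgebra.isLocalRing_quotient_X_pow_add_C p hm
    ∀ (D : DualityDatum p cd ((W.eisensteinTower κ hm).ρ k) (EisensteinCoeff p m (k + 1)))
      (e : geomTorsion (W.baseChange K) ((p : ℤ) ^ (k + 1)) →+ geomTorsion (W.baseChange K) ((p : ℤ) ^ (k + 1)) →+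
        MuCarrier K (p ^ (k + 1)))
      (log : MuCarrier K (p ^ (k + 1)) →+ ZMod (p ^ (k + 1)))
      (_hDe : D.e = ZpExtension.eisensteinDualityForm hm (k + 1) (conjPairing e (cd.isLift.torsionMap W _) log))
      (_hθθ : ∀ a : geomTorsion (W.baseChange K) ((p : ℤ) ^ (k + 1)),
        cd.isLift.torsionMap W _ (cd.isLift.torsionMap W _ a) = a),
    (∀ a b, conjPairing e (cd.isLift.torsionMap W _) log a b = conjPairing e (cd.isLift.torsionMap W _) log b a) ∧
    (∀ w, (∀ b, conjPairing e (cd.isLift.torsionMap W _) log w b = 0) → w = 0) ∧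
    (∀ b, (∀ a, conjPairing e (cd.isLift.torsionMap W _) log a b = 0) → b = 0) ∧
    (∀ a, (∀ b, log (e a b) = 0) → a = 0) ∧
    (∀ b, (∀ a, log (e a b) = 0) → b = 0) ∧
    (∀ a, (∀ b, e a b = 0) → a = 0) ∧
    (∀ b, (∀ a, e a b = 0) → b = 0) := by
  intro D e log hDe hθθ
  obtain ⟨hsymm, hndl, hndr⟩ := ZpExtension.nondegenerate_of_dualityDatum_e_eq hm (k + 1)
    D (conjPairing e (cd.isLift.torsionMap W _) log) hDe
    (W.geomTorsion_baseChange_pow_nsmul_eq_zero (K := K) (p := p) (k + 1))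
  exact ⟨hsymm, hndl, hndr, log_conjPairing_nondegenerate_left e _ log hndl,
    log_conjPairing_nondegenerate_right e _ log hθθ hndr, base_conjPairing_nondegenerate_left e _ log hndl,
    base_conjPairing_nondegenerate_right e _ log hθθ hndr⟩

end WeierstrassCurve

end
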